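import Summits.HubbardSuperconductivity.HubbardSuperconductivity.Theorems.TwSourcedCondensation.Negative.FiniteVolumeResponseBounds

/-!
# Crux `TwSourcedInertness` (item `stmt-HubbardSuperconductivity-1696`): the SUSCEPTIBILITY FORM of
the thermal-disc stub — a bound on the Kubo–Mori–Bogoliubov pair susceptibility integrates to the
crux's quadratic pressure bound

`--supports` file of the registered skeleton `work/TwSourcedInertness.lean` (prover seat 2; stubs
`stub_thermalDisc`, `stub_entropyDensity`); no definition is introduced.

The skeleton reduces the crux to its restriction to the THERMAL DISC `|h| ≤ 1/β`
(`stub_thermalDisc`: `p̃_L(β,μ,U,h) − p̃_L(β,μ,U,0) ≤ C(1+log β)h²` for `|h| ≤ 1/β`, eventually in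
`L`). What a Benfatto–Giuliani–Mastropietro-type convergent expansion WITH a pair source would
deliver is not that integrated inequality but a RESPONSE-FUNCTION bound: finiteness of the `d`-wave
pair susceptibility of the sourced torus Gibbs state, i.e. of the Kubo–Mori–Bogoliubov (Duhamel)
variance of the source operator `Q = Δ_d + Δ_d†`,

  `χ_L(β,μ,U,t) := (β/L²)·[ Re (Q,Q)_{β, H_{L,t}} − (Re ⟨Q⟩_{β, H_{L,t}})² ]`,
  `H_{L,t} = dWaveSourceTorus L U μ t = hubbardTorusWith 2 L 1 U μ − t·Q`,

which is `β⁻¹L⁻² ∂²_t log Z_β(H_{L,t})` (Dyson–Lieb–Simon 1978, eq. (5); in the tree: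
`hasDerivAt_re_gibbsState_source`, the susceptibility formula `m'(t) = β((Q,Q)_t − m(t)²)` for the
source magnetisation `m(t) = Re⟨Q⟩_{H_{L,t}}`). This file proves the bridge, for EVERY finite torus:

* `re_gibbsState_source_le_of_var_le` — (abstract, any Hermitian `H`, `A` with `⟨A⟩_H = 0`) if the
  KMB variance of `A` along the sourced family `H − sA`, `0 < s < t`, is `≤ v`, then the
  magnetisation obeys `Re⟨A⟩_{H−tA} ≤ β v t` (mean value theorem);
* `log_partitionFn_source_sub_le_of_var_le` — hence `log Z(H − tA) − log Z(H) ≤ β² v t²`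
  (Peierls–Bogoliubov at `H − tA`);
* `tw_sourcedGain_le_of_susceptibility_le` — on the torus: if `χ_L(β,μ,U,t) ≤ K` for `|t| < |h|`
  then `p̃_L(h) − p̃_L(0) ≤ K h²` (evenness in `h` by the gauge rotation handles `h < 0`);
* `tw_thermalDisc_of_discSusceptibility` — the quantified form: "`χ_L ≤ C(1+log β)` on the thermal
  disc `|t| ≤ 1/β`, for `U ≤ U₀`, `1 ≤ β ≤ e^{a/U}`, `μ ∈ [μ₁,μ₂]`, eventually in `L`" implies
  `stub_thermalDisc` VERBATIM (same constants). So the registered stub may be read as the textbook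
  statement "the `d`-wave pair susceptibility of the weakly repulsive Hubbard torus at
  `T ≥ e^{−a/U}` is `O(log β)`, uniformly for sources inside the thermal disc" — the linear-response
  (four-point, Cooper-bubble) sector of the missing sourced expansion, and nothing more.

The converse direction is false at the level of constants-free logic (a bound on `p̃` does not bound
`∂²p̃` pointwise), so the susceptibility form is the STRONGER of the two; it is recorded because it
is the form in which the input would arrive.

Sources: F. J. Dyson, E. H. Lieb, B. Simon, J. Stat. Phys. 18 (1978) 335, §3 eq. (5) and (35)
[DLS1978]; O. Bratteli, D. W. Robinson, *Operator Algebras and QSM II* (1997) §5.3–5.4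
(Peierls–Bogoliubov; perturbation of KMS states) [BratteliRobinsonII1997]; G. Benfatto,
A. Giuliani, V. Mastropietro, Ann. Henri Poincaré 7 (2006) 809, Thm. 1.1 (the expansion whose
response-function extension is the stub) [BenfattoGiulianiMastropietro2006]. Tree:
`hasDerivAt_re_gibbsState_source`, `isHermitian_sub_smul`,
`log_partitionFn_sub_le_log_partitionFn_add` (`ApproximatingHamiltonianProofs`);
`gibbsState_hubbardTorusWith_pairSource`, `partitionFn_dWaveSourceTorus_neg`
(`TwSourcedCondensation.Negative.SourceResponseStructure`).
-/

noncomputable section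

namespace Summit.HubbardSuperconductivity.HubbardSuperconductivity.Theorems

open Matrix Finset Literature.MathematicalPhysics.QuantumLattice
open Literature.Probability.LatticeModels
open Summit.HubbardSuperconductivity.HubbardSuperconductivity.Theorems.TwSourcedCondensation
open Negative
open scoped Matrix.Norms.L2Operator ComplexOrder

/-! ### Abstract: a KMB-variance bound integrates twice -/

section Abstract

variable {m : Type*} [Fintype m] [DecidableEq m]

/-- **Magnetisation from susceptibility** (mean value theorem for `m(s) = Re⟨A⟩_{H−sA}`,
`m' = β((A,A) − m²)`): if `⟨A⟩_H = 0` and the KMB variance is `≤ v` for `0 < s < t`, then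
`Re⟨A⟩_{H−tA} ≤ β v t`. [cite: DLS1978, §3 eq. (5)] -/
theorem re_gibbsState_source_le_of_var_le {H A : Matrix m m ℂ} (hH : H.IsHermitian)
    (hA : A.IsHermitian) [Nonempty m] {β : ℝ} (hβ : 0 < β) (h0 : (gibbsState β H A).re = 0)
    {t v : ℝ} (ht : 0 < t)
    (hv : ∀ s ∈ Set.Ioo (0 : ℝ) t, (duhamel β (H - (s : ℂ) • A) A A).re -
      (gibbsState β (H - (s : ℂ) • A) A).re ^ 2 ≤ v) :
    (gibbsState β (H - (t : ℂ) • A) A).re ≤ β * v * t := by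
  set f : ℝ → ℝ := fun s => (gibbsState β (H - (s : ℂ) • A) A).re with hf
  set f' : ℝ → ℝ := fun s => β * ((duhamel β (H - (s : ℂ) • A) A A).re -
    (gibbsState β (H - (s : ℂ) • A) A).re ^ 2) with hf'
  have hd : ∀ s, HasDerivAt f (f' s) s := fun s => hasDerivAt_re_gibbsState_source hH hA hβ s
  obtain ⟨ξ, hξ, hslope⟩ := exists_hasDerivAt_eq_slope f f' ht
    (fun s _ => (hd s).continuousAt.continuousWithinAt) (fun s _ => hd s)
  have hf0 : f 0 = 0 := by simp [hf, h0]
  have hbound : f' ξ ≤ β * v := by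
    have h1 := hv ξ hξ
    have h3 : f' ξ = β * ((duhamel β (H - (ξ : ℂ) • A) A A).re -
      (gibbsState β (H - (ξ : ℂ) • A) A).re ^ 2) := rfl
    rw [h3]
    exact mul_le_mul_of_nonneg_left h1 hβ.le
  have hft : f t = f' ξ * t := by
    rw [hslope, hf0, sub_zero, sub_zero, div_mul_cancel₀ _ ht.ne']
  calc (gibbsState β (H - (t : ℂ) • A) A).re = f t := rfl
    _ = f' ξ * t := hft
    _ ≤ β * v * t := mul_le_mul_of_nonneg_right hbound ht.le

/-- **Free energy from susceptibility**: under the same hypotheses,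
`log Z_β(H − tA) − log Z_β(H) ≤ β² v t²` (Peierls–Bogoliubov at `H − tA` plus the previous lemma).
[cite: DLS1978, §3] -/
theorem log_partitionFn_source_sub_le_of_var_le {H A : Matrix m m ℂ} (hH : H.IsHermitian)
    (hA : A.IsHermitian) [Nonempty m] {β : ℝ} (hβ : 0 < β) (h0 : (gibbsState β H A).re = 0)
    {t v : ℝ} (ht : 0 < t)
    (hv : ∀ s ∈ Set.Ioo (0 : ℝ) t, (duhamel β (H - (s : ℂ) • A) A A).re -
      (gibbsState β (H - (s : ℂ) • A) A).re ^ 2 ≤ v) :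
    Real.log (partitionFn β (H - (t : ℂ) • A)).re - Real.log (partitionFn β H).re ≤
      β ^ 2 * v * t ^ 2 := by
  have hHt : (H - (t : ℂ) • A).IsHermitian := isHermitian_sub_smul hH hA t
  have hW : ((t : ℂ) • A).IsHermitian := isHermitian_real_smul hA t
  have hPB := log_partitionFn_sub_le_log_partitionFn_add hHt hW β
  rw [sub_add_cancel, map_smul, smul_eq_mul, Complex.re_ofReal_mul] at hPB
  have hmag := re_gibbsState_source_le_of_var_le hH hA hβ h0 ht hv
  have step : β * (t * (gibbsState β (H - (t : ℂ) • A) A).re) ≤ β * (t * (β * v * t)) :=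
    mul_le_mul_of_nonneg_left (mul_le_mul_of_nonneg_left hmag ht.le) hβ.le
  have : β * (t * (β * v * t)) = β ^ 2 * v * t ^ 2 := by ring
  linarith

end Abstract

/-! ### The torus: susceptibility on the disc ⇒ quadratic gain on the disc -/

section Torus

variable (L : ℕ) [NeZero L]

/-- **Sourced gain from the pair susceptibility.** For `β > 0`, every `L ≥ 1`, all `U, μ` and a real
source `h`: if the per-site KMB pair susceptibility
`χ_L(t) = (β/L²)[Re (Q,Q)_{β,H_{L,t}} − (Re⟨Q⟩_{β,H_{L,t}})²]`, `Q = Δ_d + Δ_d†`, satisfies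
`χ_L(t) ≤ K` for all `|t| < |h|`, then `p̃_L(h) − p̃_L(0) ≤ K h²`. [cite: DLS1978, §3 eq. (5)] -/
theorem tw_sourcedGain_le_of_susceptibility_le {β : ℝ} (hβ : 0 < β) (U μ : ℝ) {h K : ℝ}
    (hK : ∀ t : ℝ, |t| < |h| →
      β / (L : ℝ) ^ 2 *
        ((duhamel β (dWaveSourceTorus L U μ t)
            (pairField dWaveFormFactor L + (pairField dWaveFormFactor L)ᴴ)
            (pairField dWaveFormFactor L + (pairField dWaveFormFactor L)ᴴ)).re -
          (gibbsState β (dWaveSourceTorus L U μ t)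
            (pairField dWaveFormFactor L + (pairField dWaveFormFactor L)ᴴ)).re ^ 2) ≤ K) :
    Real.log (partitionFn β (dWaveSourceTorus L U μ h)).re / (β * (L : ℝ) ^ 2) -
        Real.log (partitionFn β (dWaveSourceTorus L U μ 0)).re / (β * (L : ℝ) ^ 2) ≤
      K * h ^ 2 := by
  set Q := pairField dWaveFormFactor L + (pairField dWaveFormFactor L)ᴴ with hQdef
  have hL : (0 : ℝ) < (L : ℝ) ^ 2 := cast_sq_pos_of_neZero L
  have hden : 0 < β * (L : ℝ) ^ 2 := mul_pos hβ hL
  have hHK := isHermitian_hubbardTorusWith L 1 U μ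
  have hQ : Q.IsHermitian := isHermitian_pairField_add_conjTranspose L
  have h0 : (gibbsState β (hubbardTorusWith 2 L 1 U μ) Q).re = 0 := by
    rw [hQdef, gibbsState_hubbardTorusWith_pairSource, Complex.zero_re]
  have hK0 : dWaveSourceTorus L U μ 0 = hubbardTorusWith 2 L 1 U μ := dWaveSourceTorus_zero L U μ
  have hKt : ∀ t : ℝ, dWaveSourceTorus L U μ t = hubbardTorusWith 2 L 1 U μ - (t : ℂ) • Q :=
    fun t => rfl
  -- the positive case, for any `k` with `|k| = |h|`-sized window
  have pos_case : ∀ {k : ℝ}, 0 < k → k ≤ |h| →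
      Real.log (partitionFn β (dWaveSourceTorus L U μ k)).re / (β * (L : ℝ) ^ 2) -
        Real.log (partitionFn β (dWaveSourceTorus L U μ 0)).re / (β * (L : ℝ) ^ 2) ≤
      K * k ^ 2 := by
    intro k hk hkh
    -- variance bound on `(0,k)` in un-normalised units: `v = K L²/β`
    have hv : ∀ s ∈ Set.Ioo (0 : ℝ) k,
        (duhamel β (hubbardTorusWith 2 L 1 U μ - (s : ℂ) • Q) Q Q).re -
          (gibbsState β (hubbardTorusWith 2 L 1 U μ - (s : ℂ) • Q) Q).re ^ 2 ≤
          K * (L : ℝ) ^ 2 / β := by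
      intro s hs
      have hsabs : |s| < |h| := by
        rw [abs_of_pos hs.1]
        exact lt_of_lt_of_le hs.2 hkh
      have h1 := hK s hsabs
      rw [hKt s] at h1
      rw [le_div_iff₀ hβ]
      have h2 := mul_le_mul_of_nonneg_right h1 hL.le
      have hβL : β / (L : ℝ) ^ 2 * (L : ℝ) ^ 2 = β := div_mul_cancel₀ β hL.ne'
      have h3 : β / (L : ℝ) ^ 2 *
          ((duhamel β (hubbardTorusWith 2 L 1 U μ - (s : ℂ) • Q) Q Q).re -
            (gibbsState β (hubbardTorusWith 2 L 1 U μ - (s : ℂ) • Q) Q).re ^ 2) * (L : ℝ) ^ 2 =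
          ((duhamel β (hubbardTorusWith 2 L 1 U μ - (s : ℂ) • Q) Q Q).re -
            (gibbsState β (hubbardTorusWith 2 L 1 U μ - (s : ℂ) • Q) Q).re ^ 2) * β := by
        calc β / (L : ℝ) ^ 2 *
              ((duhamel β (hubbardTorusWith 2 L 1 U μ - (s : ℂ) • Q) Q Q).re -
                (gibbsState β (hubbardTorusWith 2 L 1 U μ - (s : ℂ) • Q) Q).re ^ 2) * (L : ℝ) ^ 2
            = (β / (L : ℝ) ^ 2 * (L : ℝ) ^ 2) *
              ((duhamel β (hubbardTorusWith 2 L 1 U μ - (s : ℂ) • Q) Q Q).re -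
                (gibbsState β (hubbardTorusWith 2 L 1 U μ - (s : ℂ) • Q) Q).re ^ 2) := by ring
          _ = ((duhamel β (hubbardTorusWith 2 L 1 U μ - (s : ℂ) • Q) Q Q).re -
                (gibbsState β (hubbardTorusWith 2 L 1 U μ - (s : ℂ) • Q) Q).re ^ 2) * β := by
              rw [hβL]; ring
      linarith
    have hmain := log_partitionFn_source_sub_le_of_var_le hHK hQ hβ h0 hk hv
    rw [hK0, hKt k, ← sub_div, div_le_iff₀ hden]
    calc Real.log (partitionFn β (hubbardTorusWith 2 L 1 U μ - (k : ℂ) • Q)).re -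
          Real.log (partitionFn β (hubbardTorusWith 2 L 1 U μ)).re
        ≤ β ^ 2 * (K * (L : ℝ) ^ 2 / β) * k ^ 2 := hmain
      _ = K * k ^ 2 * (β * (L : ℝ) ^ 2) := by field_simp
  rcases lt_trichotomy h 0 with hneg | rfl | hpos
  · have := pos_case (neg_pos.2 hneg) (by rw [abs_of_neg hneg])
    rwa [partitionFn_dWaveSourceTorus_neg, neg_sq] at this
  · simp
  · exact pos_case hpos (by rw [abs_of_pos hpos])

/-- **The thermal-disc stub in susceptibility form.** If the per-site KMB `d`-wave pair
susceptibility of the sourced torus Gibbs state is `≤ C(1 + log β)` throughout the thermal disc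
`|t| ≤ 1/β` — for every compact `[μ₁,μ₂] ⊂ (−4,0)`, some `U₀, a, C > 0`, all `0 < U ≤ U₀`,
`1 ≤ β ≤ e^{a/U}`, `μ ∈ [μ₁,μ₂]`, eventually in `L` — then the registered stub `stub_thermalDisc`
of the skeleton holds verbatim (same `U₀, a, C`): `p̃_L(h) − p̃_L(0) ≤ C(1+log β)h²` for
`|h| ≤ 1/β`. [cite: BenfattoGiulianiMastropietro2006, Thm. 1.1] -/
theorem tw_thermalDisc_of_discSusceptibility :
    (∀ μ₁ μ₂ : ℝ, -4 < μ₁ → μ₁ ≤ μ₂ → μ₂ < 0 → ∃ U₀ a C : ℝ, 0 < U₀ ∧ 0 < a ∧ 0 < C ∧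
      ∀ U : ℝ, 0 < U → U ≤ U₀ → ∀ β : ℝ, 1 ≤ β → β ≤ Real.exp (a / U) → ∀ μ ∈ Set.Icc μ₁ μ₂,
        ∃ L₀ : ℕ, ∀ (L : ℕ) [NeZero L], L₀ ≤ L → ∀ t : ℝ, |t| ≤ 1 / β →
          β / (L : ℝ) ^ 2 *
            ((Matrix.duhamel β
                (Literature.MathematicalPhysics.QuantumLattice.dWaveSourceTorus L U μ t)
                (Literature.MathematicalPhysics.QuantumLattice.pairField
                  Literature.MathematicalPhysics.QuantumLattice.dWaveFormFactor L +
                  (Literature.MathematicalPhysics.QuantumLattice.pairField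
                    Literature.MathematicalPhysics.QuantumLattice.dWaveFormFactor L)ᴴ)
                (Literature.MathematicalPhysics.QuantumLattice.pairField
                  Literature.MathematicalPhysics.QuantumLattice.dWaveFormFactor L +
                  (Literature.MathematicalPhysics.QuantumLattice.pairField
                    Literature.MathematicalPhysics.QuantumLattice.dWaveFormFactor L)ᴴ)).re -
              (Matrix.gibbsState β
                (Literature.MathematicalPhysics.QuantumLattice.dWaveSourceTorus L U μ t)
                (Literature.MathematicalPhysics.QuantumLattice.pairField
                  Literature.MathematicalPhysics.QuantumLattice.dWaveFormFactor L +
                  (Literature.MathematicalPhysics.QuantumLattice.pairField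
                    Literature.MathematicalPhysics.QuantumLattice.dWaveFormFactor L)ᴴ)).re ^ 2) ≤
            C * (1 + Real.log β)) →
    (∀ μ₁ μ₂ : ℝ, -4 < μ₁ → μ₁ ≤ μ₂ → μ₂ < 0 → ∃ U₀ a C : ℝ, 0 < U₀ ∧ 0 < a ∧ 0 < C ∧
      ∀ U : ℝ, 0 < U → U ≤ U₀ → ∀ β : ℝ, 1 ≤ β → β ≤ Real.exp (a / U) → ∀ μ ∈ Set.Icc μ₁ μ₂,
        ∃ L₀ : ℕ, ∀ (L : ℕ) [NeZero L], L₀ ≤ L → ∀ h : ℝ, |h| ≤ 1 / β →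
          (Real.log (Matrix.partitionFn β
            (Literature.MathematicalPhysics.QuantumLattice.dWaveSourceTorus L U μ h)).re /
              (β * (L : ℝ) ^ 2)) -
            (Real.log (Matrix.partitionFn β
              (Literature.MathematicalPhysics.QuantumLattice.dWaveSourceTorus L U μ 0)).re /
              (β * (L : ℝ) ^ 2)) ≤
            C * (1 + Real.log β) * h ^ 2) := by
  intro H μ₁ μ₂ h1 h12 h2
  obtain ⟨U₀, a, C, hU₀, ha, hC, hU⟩ := H μ₁ μ₂ h1 h12 h2
  refine ⟨U₀, a, C, hU₀, ha, hC, fun U hU0 hUU₀ β hβ1 hβa μ hμ => ?_⟩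
  obtain ⟨L₀, hL₀⟩ := hU U hU0 hUU₀ β hβ1 hβa μ hμ
  refine ⟨L₀, fun L _ hL h hh => ?_⟩
  have hβ : 0 < β := lt_of_lt_of_le one_pos hβ1
  exact tw_sourcedGain_le_of_susceptibility_le L hβ U μ
    (fun t ht => hL₀ L hL t (le_trans ht.le hh))

end Torus

end Summit.HubbardSuperconductivity.HubbardSuperconductivity.Theorems
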